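import Summits.QuantumFields.QCD.Theorems.HeatSlicedQuarksSmallFieldUltracontractivityFixedPointA
import Mathlib.Analysis.SpecialFunctions.Integrals.Basic

/-!
# Stub `stub_columnIntegral` of line `Sketch` (crux `InterleavedHeatSliceFlow`, item stmt-QuantumFields-8891, reshape r7)

Pure real analysis for the sliced Gram bound: Minkowski's inequality for a vector-valued time integral
(the landed duality lemma `sqrt_sum_norm_sq_le_integral_of_forall_le`) combined with the explicit
primitive of the smoothing profile,
`∫_a^b M dt/((t − a/2)√(t − a/2)) = 2M/√(a/2) − 2M/√(b − a/2) ≤ 2√2·M/√a`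
(fundamental theorem of calculus for `t ↦ −2M/√(t − a/2)`).

* `hasDerivAt_neg_two_mul_div_sqrt_sub` — the derivative of `t ↦ −2M/√(t − c)` at `t > c` is
  `M/((t − c)√(t − c))`;
* `continuousOn_div_mul_sqrt_sub_half` — the profile `t ↦ M/((t − a/2)√(t − a/2))` is continuous on
  `[a, b]` (`0 < a`);
* `integral_div_mul_sqrt_sub_half_le` — `∫_a^b M/((t − a/2)√(t − a/2)) dt ≤ 2√2·M/√a` (`0 < a ≤ b`, `0 ≤ M`);
* `stub_columnIntegral` — the registered stub.

Elementary; no named facts.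
-/

noncomputable section

namespace Summit.QuantumFields.QCD.Cruxes.InterleavedHeatSliceFlow.Sketch

open Summit.QuantumFields.QCD.Cruxes.SmallFieldUltracontractivity.PointCentredAxialParabolic
open MeasureTheory intervalIntegral

/-- Derivative of the primitive `t ↦ −2M/√(t − c)` at a point `t > c`: it is `M/((t − c)√(t − c))`. -/
theorem hasDerivAt_neg_two_mul_div_sqrt_sub (M c : ℝ) {t : ℝ} (ht : c < t) :
    HasDerivAt (fun s : ℝ => -2 * M / Real.sqrt (s - c)) (M / ((t - c) * Real.sqrt (t - c))) t := by
  have hpos : 0 < t - c := sub_pos.mpr ht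
  have hsq : Real.sqrt (t - c) ≠ 0 := (Real.sqrt_pos.mpr hpos).ne'
  have htc : t - c ≠ 0 := hpos.ne'
  have h1 : HasDerivAt (fun s : ℝ => s - c) 1 t := (hasDerivAt_id' t).sub_const c
  have h2 : HasDerivAt (fun s : ℝ => Real.sqrt (s - c)) (1 / (2 * Real.sqrt (t - c))) t :=
    h1.sqrt htc
  have h3 := (hasDerivAt_const t (-2 * M)).fun_div h2 hsq
  refine h3.congr_deriv ?_
  rw [Real.sq_sqrt hpos.le]
  field_simp
  ring

/-- The smoothing profile `t ↦ M/((t − a/2)√(t − a/2))` is continuous on `[a, b]` when `0 < a`. -/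
theorem continuousOn_div_mul_sqrt_sub_half {a : ℝ} (b M : ℝ) (ha : 0 < a) :
    ContinuousOn (fun t : ℝ => M / ((t - a / 2) * Real.sqrt (t - a / 2))) (Set.Icc a b) := by
  refine ContinuousOn.div continuousOn_const (by fun_prop) fun t ht => ?_
  have h1 : 0 < t - a / 2 := by linarith [ht.1]
  exact mul_ne_zero h1.ne' (Real.sqrt_pos.mpr h1).ne'

/-- **Time integral of the smoothing profile**: for `0 < a ≤ b` and `0 ≤ M`,
`∫_a^b M/((t − a/2)√(t − a/2)) dt ≤ 2√2·M/√a` (its exact value is `2M/√(a/2) − 2M/√(b − a/2)`,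
and `√(a/2)·√2 = √a`). -/
theorem integral_div_mul_sqrt_sub_half_le {a b M : ℝ} (ha : 0 < a) (hab : a ≤ b) (hM : 0 ≤ M) :
    ∫ t in a..b, M / ((t - a / 2) * Real.sqrt (t - a / 2)) ≤ 2 * Real.sqrt 2 * M / Real.sqrt a := by
  have hderiv : ∀ t ∈ Set.uIcc a b,
      HasDerivAt (fun s : ℝ => -2 * M / Real.sqrt (s - a / 2))
        (M / ((t - a / 2) * Real.sqrt (t - a / 2))) t := by
    intro t ht
    rw [Set.uIcc_of_le hab] at ht
    exact hasDerivAt_neg_two_mul_div_sqrt_sub M (a / 2) (by linarith [ht.1])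
  have hcont : ContinuousOn (fun t : ℝ => M / ((t - a / 2) * Real.sqrt (t - a / 2))) (Set.uIcc a b) := by
    rw [Set.uIcc_of_le hab]
    exact continuousOn_div_mul_sqrt_sub_half b M ha
  rw [integral_eq_sub_of_hasDerivAt hderiv hcont.intervalIntegrable]
  have hba : 0 < b - a / 2 := by linarith
  have hsub : 0 ≤ 2 * M / Real.sqrt (b - a / 2) := by positivity
  have ha2 : a - a / 2 = a / 2 := by ring
  have hkey : -(-2 * M / Real.sqrt (a - a / 2)) = 2 * Real.sqrt 2 * M / Real.sqrt a := by
    rw [ha2, Real.sqrt_div ha.le, div_div_eq_mul_div]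
    ring
  have hfirst : -2 * M / Real.sqrt (b - a / 2) = -(2 * M / Real.sqrt (b - a / 2)) := by ring
  calc -2 * M / Real.sqrt (b - a / 2) - -2 * M / Real.sqrt (a - a / 2)
      = 2 * Real.sqrt 2 * M / Real.sqrt a - 2 * M / Real.sqrt (b - a / 2) := by
        rw [← hkey, hfirst]; ring
    _ ≤ 2 * Real.sqrt 2 * M / Real.sqrt a := by linarith

/-- **Stub `stub_columnIntegral`** (generic real analysis): Minkowski for the time integral of a column
with the smoothed profile — if `v_q = ∫_a^b F(t)_q dt` with each `F(·)_q` continuous on `[a,b]`, `0 < a ≤ b`,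
`0 ≤ M`, and `‖F(t)‖₂ ≤ M/((t − a/2)√(t − a/2))` on `[a,b]`, then `‖v‖₂ ≤ 2√2·M/√a`
(landed `sqrt_sum_norm_sq_le_integral_of_forall_le` + `∫_a^b (t − a/2)^{−3/2} dt = 2(a/2)^{−1/2} − 2(b − a/2)^{−1/2}
≤ 2√2/√a`, FTC for `t ↦ −2/√(t − a/2)`). -/
theorem stub_columnIntegral :
    ∀ (ι : Type) [Fintype ι] (v : ι → ℂ) (F : ℝ → ι → ℂ) (a b M : ℝ), 0 < a → a ≤ b → 0 ≤ M →
      (∀ q, v q = ∫ t in a..b, F t q) → (∀ q, ContinuousOn (fun t => F t q) (Set.Icc a b)) →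
      (∀ t, a ≤ t → t ≤ b →
        Real.sqrt (∑ q, ‖F t q‖ ^ 2) ≤ M / ((t - a / 2) * Real.sqrt (t - a / 2))) →
      Real.sqrt (∑ q, ‖v q‖ ^ 2) ≤ 2 * Real.sqrt 2 * M / Real.sqrt a := by
  intro ι _ v F a b M ha hab hM hv hF hbound
  have hmink := sqrt_sum_norm_sq_le_integral_of_forall_le v F
    (fun t : ℝ => M / ((t - a / 2) * Real.sqrt (t - a / 2))) hab hF
    (continuousOn_div_mul_sqrt_sub_half b M ha) hv (fun t ht => hbound t ht.1 ht.2)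
  exact hmink.trans (integral_div_mul_sqrt_sub_half_le ha hab hM)

end Summit.QuantumFields.QCD.Cruxes.InterleavedHeatSliceFlow.Sketch

end
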